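import Summits.HodgeConjecture.HodgeConjecture.Theorems.Ring2AbelianAllAndreLevels
import Summits.HodgeConjecture.HodgeConjecture.Theorems.Ring2AbelianAllAndreSporadicClasses
import HarnessLib

/-!
# Ring 2 · sub-cell AbelianAll (ALL ABELIAN VARIETIES), André axis, part XXXIII-f — THE LEVELS ARE LINEARLY ORDERED: the lift
# statement for middle-dimensional classes on compact pencils of abelian `2k'`-folds IMPLIES the one on pencils of abelian
# `2k`-folds for every `k ≤ k'` (fact-free: pad, reflect across the middle of the padded pencil, pad again); hence (L) is
# equivalent to its restriction to pencils of ARBITRARILY LARGE relative dimension, `(L) ⟺ (L)^mid_{≥K}` for EVERY `K` with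
# no named fact, and the graded cost collapses to ONE CELL: `HC_CM ∧ LiftMidAt[2G] ⟹ HCUpToDim G` modulo Lemme 6.3.1

HONEST FRAMING (page 1, verbatim): **research route, not a corollary; conditional on HC_CM plus one named
minimal statement.** Cell line: research route conditional on HC_CM; not a corollary; Q11.4-sentence-2 already
refuted in dim ≥ 3. Nothing in this file proves a case of the Hodge conjecture for an abelian variety. `HC_CM`
(`Theses.RankFourFaces.CMAbelianHodge`), `HC_AV` (`Theses.PadicSemiregularLift.HodgeAbelianVarieties`), `HCAtDim`, `HCUpToDim`
are BINDERS wherever they occur; `h₂₁` = André's Lemme 6.3.1 and `hGT` = Verdier 1976 are NAMED-FACT BINDERS, never facts; the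
reduction item `CMToAbelian` (stmt-16267) is NOT closed; the cell's `B_min` of record (N104) is untouched; NO node is born (the level
forms `LiftMidAt[k]`, `TransportMidAt[k]` are the FILE-LOCAL NOTATIONS of part XXXIII-d, restated byte for byte); nothing is claimed
minimal; 0 `def`, 0 `sorry`, axioms standard.

## What this part does (brief (ii)/(iii))

Part XXXIII-d graded the André axis by the dimension `k` of the cycles: level `k` = the single cell `(2k, k)`, `LiftMidAt[k]` /
`TransportMidAt[k]`. This part proves that THE LEVELS ARE MONOTONE:

* §1 **`liftMidAt_of_liftMidAt_add` / `liftMidAt_anti` — `LiftMidAt[k'] ⟹ LiftMidAt[k]` for `k ≤ k'`, FACT-FREE.** Given a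
  compact pencil `f` of abelian `2k`-folds, a CM point `t` and `r = k' - k`: pad by a CM abelian variety `B` of dimension `r`
  (part XXXII-a/b: the lift of `f` at degree `k` follows from the lift of `B × 𝒳 ⟶ S` at degree `k + r`, a cell ABOVE the
  middle of the padded pencil of relative dimension `2k + r`); reflect across the middle (part XXX-b `comap_le_sup_compl_of_le'`:
  on one pencil the lift at degree `p` gives the lift at degree `d - p`, `p ≤ d - p` — Lieberman on the fibre, fact-free), so
  it follows from the lift of `B × 𝒳 ⟶ S` at degree `k` (level `k + r`); pad once more by `B`: that follows from the lift of
  `B × B × 𝒳 ⟶ S` at its MIDDLE degree `k + r` — an instance of `LiftMidAt[k + r]`.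
* §2 `cmFibreAlgebraicLift_iff_liftMidAt_ge` — **(L) ⟺ ⋀_{k ≥ K} LiftMidAt[k] for EVERY `K ≥ 2`**, FACT-FREE: the lift node is
  equivalent to its restriction to compact pencils of abelian varieties of ARBITRARILY LARGE (even) relative dimension, middle
  degree; `cmFibreAlgebraicLift_of_frequently_liftMidAt` — `LiftMidAt[k]` for infinitely many `k` suffices. In particular
  **`(L) ⟺ ⋀_{k ≥ 3} LiftMidAt[k]` with NO named fact** (part XXXII-c needed [Verdier, Moonen–Zarhin, Markman] and part XXXIII-d
  rev 2 the Weil floor to discard the level `2`: the level `3` discards it by itself).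
* §3 transport: `transportMidAt_of_liftMidAt` (fact-free, part XXXI-a `forall_mem_algebraicClasses_of_comap_le_sup`),
  `liftMidAt_of_transportMidAt_of_verdier`, hence **`transportMidAt_anti_of_verdier` — `TransportMidAt[k'] ⟹ TransportMidAt[k]`,
  `k ≤ k'`, modulo Verdier** and `cmAnchoredTransport_iff_transportMidAt_ge_of_verdier`. (A fact-free transport monotonicity is
  NOT claimed: the reflection step in transport form needs rational `(p,p)` data on the PADDED class, which the tree's Gysin
  maps — defined up to the complex scalars of an orientation family — do not provide.)
* §4 **THE GRADED COST COLLAPSES TO ONE CELL: `hcUpToDim_of_HC_CM_of_liftMidAt` — `HC_CM ∧ LiftMidAt[2G] ⟹ HCUpToDim G` modulo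
  Lemme 6.3.1** (part XXXIII-d's cost `⋀_{2 ≤ k ≤ 2G} TransportMidAt[k]` is implied by the single top level through §1 and §3):
  the Hodge conjecture for complex abelian varieties of dimension `≤ G` costs, on this axis, `HC_CM` and ONE statement — every
  middle-dimensional invariant algebraic class of a CM fibre of a compact pencil of abelian `4G`-folds is the restriction of an
  algebraic class of the `(4G+1)`-fold total space (modulo the classes dying on the fibre). `HC_AV_iff_HC_CM_and_liftMidAt_ge_of_verdier`
  — `HC_AV ⟺ HC_CM ∧ ⋀_{k ≥ K} LiftMidAt[k]` (any `K`) modulo [6.3.1, Verdier]; `HC_AV_of_HC_CM_of_frequently_liftMidAt` — `HC_CM`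
  and `LiftMidAt[k]` for infinitely many `k` give `HC_AV` modulo 6.3.1 alone.

READING. (1) There is no "first cell with independent content" on the André axis: every cell is implied by every middle cell of
higher level; what the tree KNOWS starts failing at level `3` (parts XXXII-e, XXXIII-d), but logically `(6, 3) ⟸ (8, 4) ⟸ (10, 5) ⟸ …`.
(2) The no-bootstrap reading of part XXXIII-d made quantitative: `HC` in dimension `4G` supplies `LiftMidAt[2G]` (modulo Verdier,
part XXXIII-d §3), which returns `HC` in dimension `≤ G` — a factor `4` in the dimension, never a gain. (3) Equivalent FORMS only:
`LiftMidAt[k]` for large `k` is a RESTRICTION of (L), implied by it and implying it; no node, no candidate; N104 untouched;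
«minimal» claimed nowhere.

References: Andre1996Motifs (§5.1 p. 25; §6.3 Lemme 6.3.1 p. 31, a) p. 33); Lieberman1968 (Thm. 1); Kleiman1968AlgebraicCycles (§2
Thm. 2A11); Milne2020HodgeClassesAV (Prop. 1 p. 7); BrosnanFangNiePearlstein2009 (§6 Lemma 48); Fulton1998 (Prop. 1.7, Thm. 6.2 (a));
Verdier1976 (Cor. (5.1)); CharlesSchnell2014Notes (Cor. 11.3.6, Prop. 11.3.11); Abdulali1994FamiliesAV (Lemma 6.2 p. 1131).
-/

noncomputable section

set_option linter.dupNamespace false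

namespace Summit.HodgeConjecture.HodgeConjecture.Ring2.AbelianAll

open CategoryTheory CategoryTheory.Limits AlgebraicGeometry MonoidalCategory CartesianMonoidalCategory
open Literature.AlgebraicGeometry Literature.AlgebraicGeometry.Motives
open Literature.AlgebraicGeometry.HodgeTheory
open Literature.AlgebraicGeometry.Deligne1982 (cmLocus)
open Literature.AlgebraicGeometry.Milne1999 (IsOfCMType)
open Literature.AlgebraicGeometry.Andre1996 (andre1996_cmAnchoredPencil)
open Summit.HodgeConjecture.HodgeConjecture
open Summit.HodgeConjecture.HodgeConjecture.Theses
open Summit.HodgeConjecture.HodgeConjecture.Ring2.Deform (HC_CM_of_HC_AV)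
open Summit.HodgeConjecture.HodgeConjecture.Ring2.ClassTargets (HCAtDim HCUpToDim)

variable {𝒳 S : SchemeOver ℂ}

/-! ## §0 The level forms (file-local notations of part XXXIII-d, byte for byte) -/

/-- `TransportMidAt[k]` — CM-anchored transport of MIDDLE-degree complex classes on compact pencils of abelian varieties of relative
dimension EXACTLY `2k` (file-local notation, as in part XXXIII-d). -/
local notation3 (prettyPrint := false) "TransportMidAt[" k "]" =>
  ∀ ⦃𝒳 S : SchemeOver ℂ⦄ (f : 𝒳 ⟶ S), IsCompactAbelianPencil f (2 * k) →
    ∀ (W : complexBetti 𝒳 (2 * k)), ∀ t ∈ cmLocus f (2 * k),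
      complexBetti.map (fiberι f t) (2 * k) W ∈ algebraicClasses (fiberOver f t) k →
      ∀ s : ComplexPoints S, complexBetti.map (fiberι f s) (2 * k) W ∈ algebraicClasses (fiberOver f s) k

/-- `LiftMidAt[k]` — the lift (L) in lattice form for MIDDLE-degree classes at CM points of compact pencils of abelian varieties of
relative dimension EXACTLY `2k` (file-local notation, as in part XXXIII-d). -/
local notation3 (prettyPrint := false) "LiftMidAt[" k "]" =>
  ∀ ⦃𝒳 S : SchemeOver ℂ⦄ (f : 𝒳 ⟶ S), IsCompactAbelianPencil f (2 * k) →
    ∀ t ∈ cmLocus f (2 * k),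
      (algebraicClasses (fiberOver f t) k).comap (complexBetti.map (fiberι f t) (2 * k)).hom ≤
        algebraicClasses 𝒳 k ⊔ LinearMap.ker (complexBetti.map (fiberι f t) (2 * k)).hom

/-! ## §1 The lift levels are monotone — FACT-FREE -/

/-- **`LiftMidAt[k + r] ⟹ LiftMidAt[k]`** — pad by a CM abelian variety `B` of dimension `r`, reflect across the middle of
`B × 𝒳 ⟶ S` (part XXX-b, Lieberman on the fibre), pad by `B` again: the lift of `f` at its middle degree `k` follows from the
lift of `B × B × 𝒳 ⟶ S` at ITS middle degree `k + r`, at the same CM point. FACT-FREE. [cite: Lieberman1968, Thm. 1]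
[cite: BrosnanFangNiePearlstein2009, §6 Lemma 48] [cite: Fulton1998, Prop. 1.7 and Thm. 6.2 (a)] -/
theorem liftMidAt_of_liftMidAt_add (k r : ℕ) (h : LiftMidAt[k + r]) : LiftMidAt[k] := by
  intro 𝒳 S f hf t ht
  rcases Nat.eq_zero_or_pos r with hr | hr
  · subst hr
    exact h f hf t ht
  obtain ⟨B, hBd, hBcm⟩ := exists_isOfCMType_dim_eq_succ (r - 1)
  obtain rfl : r = B.dim := by omega
  -- the padded pencil `g = B × 𝒳 ⟶ S`, relative dimension `B.dim + 2k`, CM at `t`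
  have hg : IsCompactAbelianPencil (snd B.X 𝒳 ≫ f) (B.dim + 2 * k) := isCompactAbelianPencil_snd_comp hf B
  have htg : t ∈ cmLocus (snd B.X 𝒳 ≫ f) (B.dim + 2 * k) := cmLocus_subset_cmLocus_snd_comp f B hBcm ht
  -- pad: the lift of `f` at degree `k` from the lift of `g` at degree `k + B.dim` (above the middle of `g`)
  refine comap_le_sup_of_snd_comp' hf B ?_
  -- reflect: the lift of `g` at degree `k + B.dim` from the lift of `g` at degree `k` (below the middle of `g`)
  refine comap_le_sup_compl_of_le' hg t (p := k) (q := k + B.dim) (by omega) (by omega) ?_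
  -- pad again: the lift of `g` at degree `k` from the lift of `B × B × 𝒳 ⟶ S` at its middle degree `k + B.dim`
  have hn : B.dim + (B.dim + 2 * k) = 2 * (k + B.dim) := by omega
  exact comap_le_sup_of_snd_comp' hg B
    (h _ (isCompactAbelianPencil_snd_comp_of_eq hg B hn) t (mem_cmLocus_snd_comp_of_eq _ B hBcm hn htg))

/-- **THE LIFT LEVELS ARE MONOTONE: `LiftMidAt[k'] ⟹ LiftMidAt[k]` for `k ≤ k'`**, FACT-FREE. [cite: Lieberman1968, Thm. 1]
[cite: Milne2020HodgeClassesAV, Prop. 1 (p. 7)] [cite: Fulton1998, Prop. 1.7 and Thm. 6.2 (a)] -/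
theorem liftMidAt_anti {k k' : ℕ} (hkk' : k ≤ k') (h : LiftMidAt[k']) : LiftMidAt[k] := by
  obtain ⟨r, rfl⟩ : ∃ r, k' = k + r := ⟨k' - k, by omega⟩
  exact liftMidAt_of_liftMidAt_add k r h

/-! ## §2 (L) is its restriction to pencils of arbitrarily large relative dimension — FACT-FREE -/

/-- **(L) ⟺ ⋀_{k ≥ K} LiftMidAt[k] for EVERY `K ≥ 2`** — the lift node is equivalent to its restriction to the middle degree of
compact pencils of abelian varieties of even relative dimension `≥ 2K`, for any `K`. FACT-FREE. [cite: Milne2020HodgeClassesAV, Prop. 1 (p. 7)]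
[cite: Andre1996Motifs, §5.1 (p. 25)] [cite: Lieberman1968, Thm. 1] -/
theorem cmFibreAlgebraicLift_iff_liftMidAt_ge {K : ℕ} (hK : 2 ≤ K) :
    CMFibreAlgebraicLift ↔ ∀ k : ℕ, K ≤ k → LiftMidAt[k] := by
  rw [cmFibreAlgebraicLift_iff_forall_liftMidAt]
  refine ⟨fun h k hk ↦ h k (le_trans hK hk), fun h k _ ↦ ?_⟩
  rcases Nat.lt_or_ge k K with hkK | hkK
  · exact liftMidAt_anti hkK.le (h K le_rfl)
  · exact h k hkK

/-- **(L) ⟺ ⋀_{k ≥ 3} LiftMidAt[k] with NO named fact** (the level `2` — middle classes on pencils of abelian fourfolds — is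
implied by the level `3`; compare part XXXII-c's `cmFibreAlgebraicLift_iff_liftMid_three_of_verdier` [Verdier, Moonen–Zarhin,
Markman] and part XXXIII-d rev 2 [the Weil floor]). [cite: Lieberman1968, Thm. 1] [cite: Milne2020HodgeClassesAV, Prop. 1 (p. 7)] -/
theorem cmFibreAlgebraicLift_iff_liftMidAt_three : CMFibreAlgebraicLift ↔ ∀ k : ℕ, 3 ≤ k → LiftMidAt[k] :=
  cmFibreAlgebraicLift_iff_liftMidAt_ge (by norm_num)

/-- **`LiftMidAt[k]` for INFINITELY MANY `k` gives (L).** FACT-FREE. [cite: Milne2020HodgeClassesAV, Prop. 1 (p. 7)] -/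
theorem cmFibreAlgebraicLift_of_frequently_liftMidAt (h : ∀ K : ℕ, ∃ k : ℕ, K ≤ k ∧ LiftMidAt[k]) : CMFibreAlgebraicLift := by
  refine (cmFibreAlgebraicLift_iff_liftMidAt_ge (K := 2) le_rfl).2 fun k _ ↦ ?_
  obtain ⟨k', hkk', hk'⟩ := h k
  exact liftMidAt_anti hkk' hk'

/-! ## §3 Transport: fact-free from the lift, monotone modulo Verdier -/

/-- **`LiftMidAt[k] ⟹ TransportMidAt[k]`** (the lift at `t` transports algebraicity out of `𝒳_t`, part XXXI-a
`forall_mem_algebraicClasses_of_comap_le_sup`; flat sections and fibre restriction). FACT-FREE. [cite: Andre1996Motifs, §5.1 (A4) (p. 25)]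
[cite: Fulton1998, §10.1 Cor. 10.1 and §19.2 Cor. 19.2 (b)] -/
theorem transportMidAt_of_liftMidAt {k : ℕ} (h : LiftMidAt[k]) : TransportMidAt[k] :=
  fun _ _ f hf _ t ht hW s ↦
    forall_mem_algebraicClasses_of_comap_le_sup hf.isSmoothProjective_base hf.isSmoothProjectiveFamily (h f hf t ht) hW s

/-- **`TransportMidAt[k] ⟹ LiftMidAt[k]` modulo Verdier** (part XXXI-a's pointwise exactness
`comap_le_sup_iff_forall_transport_of_verdier`: a class algebraic on every fibre lifts). [cite: Verdier1976, Cor. (5.1)]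
[cite: CharlesSchnell2014Notes, Prop. 11.3.11 (proof)] -/
theorem liftMidAt_of_transportMidAt_of_verdier (hGT : Verdier1976_genericLocalTriviality) {k : ℕ} (h : TransportMidAt[k]) :
    LiftMidAt[k] :=
  fun _ _ f hf t ht ↦ (comap_le_sup_iff_forall_transport_of_verdier hGT hf.isSmoothProjective_base hf.isSmoothProjective_total
    hf.isSmoothProjectiveFamily k t).2 fun W hW s ↦ h f hf W t ht hW s

/-- **THE TRANSPORT LEVELS ARE MONOTONE modulo Verdier: `TransportMidAt[k'] ⟹ TransportMidAt[k]`, `k ≤ k'`** (through the lift).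
A fact-free transport monotonicity is not claimed. [cite: Verdier1976, Cor. (5.1)] [cite: Lieberman1968, Thm. 1] -/
theorem transportMidAt_anti_of_verdier (hGT : Verdier1976_genericLocalTriviality) {k k' : ℕ} (hkk' : k ≤ k')
    (h : TransportMidAt[k']) : TransportMidAt[k] :=
  transportMidAt_of_liftMidAt (liftMidAt_anti hkk' (liftMidAt_of_transportMidAt_of_verdier hGT h))

/-- **(4) ⟺ ⋀_{k ≥ K} TransportMidAt[k] for every `K ≥ 2`, modulo Verdier.** [cite: Verdier1976, Cor. (5.1)]
[cite: Andre1996Motifs, §6.3 a) (p. 33)] -/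
theorem cmAnchoredTransport_iff_transportMidAt_ge_of_verdier (hGT : Verdier1976_genericLocalTriviality) {K : ℕ} (hK : 2 ≤ K) :
    CMAnchoredTransport ↔ ∀ k : ℕ, K ≤ k → TransportMidAt[k] := by
  rw [cmAnchoredTransport_iff_forall_transportMidAt]
  refine ⟨fun h k hk ↦ h k (le_trans hK hk), fun h k _ ↦ ?_⟩
  rcases Nat.lt_or_ge k K with hkK | hkK
  · exact transportMidAt_anti_of_verdier hGT hkK.le (h K le_rfl)
  · exact h k hkK

/-! ## §4 The graded cost collapses to one cell -/

/-- **`HC_CM ∧ LiftMidAt[2G] ⟹ HCUpToDim G`, modulo Lemme 6.3.1** — the Hodge conjecture for complex abelian varieties of dimension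
`≤ G` from `HC_CM` and ONE statement: the lift of middle-dimensional invariant algebraic classes of CM fibres on compact pencils of
abelian `4G`-folds (which gives every level `k ≤ 2G` by §1, hence every transport level by §3, hence part XXXIII-d's graded cost).
research route, not a corollary; conditional on HC_CM plus one named minimal statement. [cite: Andre1996Motifs, Lemme 6.3.1 (p. 31) and §6.3 a) (p. 33)]
[cite: Lieberman1968, Thm. 1] [cite: Milne2020HodgeClassesAV, Prop. 1 (p. 7)] -/
theorem hcUpToDim_of_HC_CM_of_liftMidAt (h₂₁ : andre1996_cmAnchoredPencil) (hCM : RankFourFaces.CMAbelianHodge) (G : ℕ)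
    (hL : LiftMidAt[2 * G]) : HCUpToDim G :=
  hcUpToDim_of_HC_CM_of_transportMidAt h₂₁ hCM G fun _ _ hkG ↦ transportMidAt_of_liftMidAt (liftMidAt_anti hkG hL)

/-- **`HC_CM ∧ LiftMidAt[2g] ⟹ HCAtDim g`**, modulo Lemme 6.3.1 (one dimension). E.g. `g = 4`: the abelian fourfolds from `HC_CM`
and the middle lift on compact pencils of abelian `16`-folds. research route, not a corollary; conditional on HC_CM plus one named
minimal statement. [cite: Andre1996Motifs, Lemme 6.3.1 (p. 31) and §6.3 a) (p. 33)] -/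
theorem hcAtDim_of_HC_CM_of_liftMidAt (h₂₁ : andre1996_cmAnchoredPencil) (hCM : RankFourFaces.CMAbelianHodge) (g : ℕ)
    (hL : LiftMidAt[2 * g]) : HCAtDim g :=
  fun A hA ↦ hcUpToDim_of_HC_CM_of_liftMidAt h₂₁ hCM g hL A hA.le

/-- **`HC_CM` and `LiftMidAt[k]` for INFINITELY MANY `k` give `HC_AV`**, modulo Lemme 6.3.1 alone. research route, not a corollary;
conditional on HC_CM plus one named minimal statement. [cite: Andre1996Motifs, Lemme 6.3.1 (p. 31) and §6.3 a) (p. 33)] -/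
theorem HC_AV_of_HC_CM_of_frequently_liftMidAt (h₂₁ : andre1996_cmAnchoredPencil) (hCM : RankFourFaces.CMAbelianHodge)
    (h : ∀ K : ℕ, ∃ k : ℕ, K ≤ k ∧ LiftMidAt[k]) : PadicSemiregularLift.HodgeAbelianVarieties :=
  HC_AV_of_HC_CM_and_cmFibreAlgebraicLift h₂₁ hCM (cmFibreAlgebraicLift_of_frequently_liftMidAt h)

/-- **`HC_AV ⟺ HC_CM ∧ ⋀_{k ≥ K} LiftMidAt[k]` for every `K ≥ 2`, modulo [Lemme 6.3.1, Verdier]** (Verdier only for the necessity of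
the lift form). research route, not a corollary; conditional on HC_CM plus one named minimal statement.
[cite: Andre1996Motifs, Lemme 6.3.1 (p. 31)] [cite: Verdier1976, Cor. (5.1)] -/
theorem HC_AV_iff_HC_CM_and_liftMidAt_ge_of_verdier (h₂₁ : andre1996_cmAnchoredPencil) (hGT : Verdier1976_genericLocalTriviality)
    {K : ℕ} (hK : 2 ≤ K) :
    PadicSemiregularLift.HodgeAbelianVarieties ↔ RankFourFaces.CMAbelianHodge ∧ ∀ k : ℕ, K ≤ k → LiftMidAt[k] :=
  ⟨fun h ↦ ⟨HC_CM_of_HC_AV h, fun k _ ↦ liftMidAt_of_transportMidAt_of_verdier hGT (transportMidAt_of_HC_AV h k)⟩,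
    fun h ↦ HC_AV_of_HC_CM_and_cmFibreAlgebraicLift h₂₁ h.1 ((cmFibreAlgebraicLift_iff_liftMidAt_ge hK).2 h.2)⟩

end Summit.HodgeConjecture.HodgeConjecture.Ring2.AbelianAll

end
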